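import Mathlib
import Literature.MathematicalPhysics.QuantumFieldTheory.Balaban1983to89.B5Identities197Torus

/-!
# `Balaban1983to89.B8Eq158FlatTorus` — T. Bałaban, *Spaces of regular gauge field configurations on a lattice and gauge
# fixing conditions*, Commun. Math. Phys. **99** (1985) 75–102 [Balaban1985RegularSpaces], (1.58) p. 86: the operator
# G(U₀) = (D\*D + DRD\* + Σ_jQ\*_jΛ_j(L^jη)⁻²Q_j)⁻¹ AT THE FLAT BACKGROUND U₀ = 1 for the constant domain sequence
# Ω₀ = … = Ω_k = T_η, ON THE TORUS OF RECORD — it IS [B5]'s G = Δ_a⁻¹ of (1.69)–(1.71) (`B5DeltaA169`), so the displayed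
# invertibility hypothesis of `B8Eq157Translation` HOLDS there ([B5] p. 30; the U = 1 case of [4] (3.26)/Thm 3.11), there are
# no zero modes, and (1.57)/(1.58) read on the torus with G(1) = [B5]'s `calG`

statement-level skeleton of published theorems with citation tags; proofs where landed; nothing here is a claim about the Yang–Mills mass gap

PDF held: `paper:balaban1985-cmp99-regular-spaces-gauge-fixing` (journal page = PDF page + 74), p. 86 [PDF 12] read AS AN IMAGE this
session (render `run/shared/lean/pub/pub-balaban/b2b-balaban-ref1/pages/1985-cmp99-regular-spaces-gauge-fixing-p012-x2.png`);
[4] = T. Bałaban, *Propagators for lattice gauge theories in a background field*, CMP **99** (1985) 389–434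
[Balaban1985BackgroundPropagators] p. 395 [PDF 7] from the `lit read` text layer; [B5] = T. Bałaban, *Propagators and
renormalization transformations for lattice gauge theories. I*, CMP **95** (1984) 17–40 [Balaban1984PropagatorsI] pp. 25, 29–30
[PDF 9, 13–14] from the `lit read` text layer (quotations also in the headers of `B5DeltaA169`, `B5Identities197Torus`).

CITATION HEADER (lean-in-tree rule).  Cell `lit-balaban`, unit `lit-balaban-r05` gen 11 (B8 fold owner); companion of
`B8Eq157Translation` (p299834; SKELETON row **B8.Eq1.58**), whose every use of G(U₀) carries the DISPLAYED hypothesis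
`IsUnit (P8 …).det` («introduced and investigated in [4]»; [4] Thm 3.11 «Δ_a, G are positive definite»).  [4] p. 395:
*"Δ_a(U) = Δ(U) + D_UR(U)D\*_U + Q\*(U)aQ(U), (3.26) or simply Δ_a = Δ + DRD\* + Q\*aQ. It coincides with Δ_a in (2.19) if
U = 1."* — and at U = 1 the positivity is the already-published flat theory: [B5] (1.69) *"⟨A, Δ_aA⟩ = ⟨A, ∂\*∂A⟩ + ⟨A, ∂R∂\*A⟩ +
a⟨A, Q\*QA⟩ = ⟨A, ΔA⟩ − ⟨A, ∂P∂\*A⟩ + a⟨A, Q\*QA⟩, Δ = ∂\*∂ + ∂∂\*, R = I − P"*, (1.71) *"Δ_a⁻¹ = G_k, or simply G"*, p. 30 *"At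
first let us prove that Δ_a is a positive operator. Of course it is a symmetric operator and it is non-negative … so A = 0"*,
kernel-checked on the torus of record by the pub-balaban/B5 lineage (`B5DeltaA169.DeltaA`, `isUnit_DeltaA`, `DeltaA_posDef`,
`calG`; `B5Identities197Torus.DeltaA_eq_curl_RT`: Δ_a = ∂\*∂ + ∂R∂\* + aQ\*Q with R = `RT` = *"an orthogonal projection on the
linear subspace ΔN(Q′_k) of L²(T_η)"* ([B5] p. 25) — B8's R(U₀) of (1.27)/(1.38) at U₀ = 1, [4] (3.20)).  WHAT THIS MODULE
RECORDS: for B8's constant domain sequence Ω₀ = Ω₁ = … = Ω_k = T_η (admissible; then Λ_j = ∅ for j < k, Λ_k = T^{(k)} and the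
sum Σ_jQ\*_jΛ_j(L^jη)⁻²Q_j has the single term (L^kη)⁻²Q\*_kQ_k) and U₀ = 1, B8's operator of (1.58) IS [B5]'s Δ_a with
a = (L^kη)⁻² — so G(1) EXISTS there with no hypothesis, and (1.57)/(1.58) hold on the torus for every A subject to (1.55),
(1.42), «L^kηQ_kA = B₁».  Kind «definition + kernel-checked dictionary»; no `… : Prop` fact; 0 sorry.  NOT here: any
U₀ ≠ 1, any non-constant domain sequence, the sup-norm bounds (1.59) ([4] Thm 3.3; the torus gives [B5]'s L² bound (1.89)
instead, `opNorm_G8T_le`), the operator H(U₀) on the torus (its (45)-properties enter `eq158_line1_torus` as hypotheses, as in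
`B8Eq157Translation.eq157`).

DICTIONARY (declared readings).  Torus of record `T_η = Tor (fine n M)` (η = 1/n, n ≥ 1), vector fields `T_η × Fin d → ℂ`, unit
lattice `Tor M`; D^η (sites → bonds) = `GradOp (fine n M) n`, D^{η\*} = its conjugate transpose; B8's D\*D on vector fields ((1.1)/(1.2),
each unordered plaquette once) = ½·`CurlOp`ᴴ`CurlOp` (r02's `CurlOp` runs over ORDERED direction pairs; [B5] «Δ = ∂\*∂ + ∂∂\*»,
`curl_adjoint_curl`); Q_k = `QvOp n M`, Q\*_k = `QvAdj n M` (the η^{−d}-weighted adjoint of [B5] (1.18)); R(1) = `RT n M`;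
ℓ₀ := L^kη > 0 the one surviving level weight, a := ℓ₀⁻².  Complex scalars (the B5 typing; `B8Eq157Translation` is over ℝ, so its
letters are re-read here rather than instantiated).
-/

namespace Literature.MathematicalPhysics.QuantumFieldTheory.Balaban1983to89.B8Eq158FlatTorus

open Matrix
open scoped Matrix Matrix.Norms.L2Operator ComplexOrder
open B5Prop11Plancherel (Tor fine calG Cst)
open B5Action121 (CurlOp GradOp)
open B5Block118 (QvOp)
open B5DeltaA169 (QvAdj DeltaA)
open B5Identities197Torus (RT)

noncomputable section

variable {d : ℕ} (n : ℕ) [NeZero n] (M : Fin d → ℕ) [hM : ∀ μ, NeZero (M μ)]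

/-! ## §1  B8's operator of (1.58) at U₀ = 1 on the torus IS [B5]'s Δ_a -/

/-- **B8's P₈ = D\*D + DRD\* + Σ_jQ\*_jΛ_j(L^jη)⁻²Q_j at U₀ = 1, Ω₀ = … = Ω_k = T_η** (one surviving term, weight ℓ₀ = L^kη):
`½·CurlOpᴴCurlOp + GradOp·R·GradOpᴴ + ℓ₀⁻²·Q*Q` on the torus of record. [cite: Balaban1985RegularSpaces, (1.58) p.86] -/
def P8T (ℓ₀ : ℝ) : Matrix (Tor (fine n M) × Fin d) (Tor (fine n M) × Fin d) ℂ :=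
  (1 / 2 : ℂ) • ((CurlOp (fine n M) (n : ℂ))ᴴ * CurlOp (fine n M) (n : ℂ))
    + GradOp (fine n M) (n : ℂ) * RT n M * (GradOp (fine n M) (n : ℂ))ᴴ
    + ((ℓ₀⁻¹ ^ 2 : ℝ) : ℂ) • (QvAdj n M * QvOp n M)

/-- **«It coincides with Δ_a … if U = 1»** ([4] p.395 for (3.26)): B8's operator at U₀ = 1 on the torus IS [B5]'s Δ_a of (1.69)
with a = (L^kη)⁻² — `B5Identities197Torus.DeltaA_eq_curl_RT` read backwards.
[cite: Balaban1985BackgroundPropagators, (3.26) p.395; Balaban1984PropagatorsI, (1.69) p.29] -/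
theorem P8T_eq_DeltaA (ℓ₀ : ℝ) : P8T n M ℓ₀ = DeltaA n M (ℓ₀⁻¹ ^ 2) :=
  (B5Identities197Torus.DeltaA_eq_curl_RT n M (ℓ₀⁻¹ ^ 2)).symm

/-- P₈ applied: `P₈A = ½Curlᴴ(Curl A) + ∂(R(∂ᴴA)) + ℓ₀⁻²·Q*(QA)`. [cite: Balaban1985RegularSpaces, (1.58) p.86] -/
theorem P8T_mulVec (ℓ₀ : ℝ) (A : Tor (fine n M) × Fin d → ℂ) :
    P8T n M ℓ₀ *ᵥ A = (1 / 2 : ℂ) • ((CurlOp (fine n M) (n : ℂ))ᴴ *ᵥ (CurlOp (fine n M) (n : ℂ) *ᵥ A))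
      + GradOp (fine n M) (n : ℂ) *ᵥ (RT n M *ᵥ ((GradOp (fine n M) (n : ℂ))ᴴ *ᵥ A))
      + ((ℓ₀⁻¹ ^ 2 : ℝ) : ℂ) • (QvAdj n M *ᵥ (QvOp n M *ᵥ A)) := by
  simp only [P8T, add_mulVec, smul_mulVec, mulVec_mulVec, Matrix.mul_assoc]

/-- **G(1) := P₈⁻¹** on the torus — B8's G(U₀) of (1.58) at U₀ = 1 for the constant domain sequence.
[cite: Balaban1985RegularSpaces, (1.58) p.86] -/
def G8T (ℓ₀ : ℝ) : Matrix (Tor (fine n M) × Fin d) (Tor (fine n M) × Fin d) ℂ := (P8T n M ℓ₀)⁻¹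

/-- positivity of the weight a = ℓ₀⁻². [folklore] -/
private theorem a_pos {ℓ₀ : ℝ} (hℓ : 0 < ℓ₀) : 0 < ℓ₀⁻¹ ^ 2 := by positivity

/-- **G(1) = [B5]'s G = Δ_a⁻¹ (1.71)** (`B5Prop11Plancherel.calG`, the Fourier-block operator of (1.83), = Δ_a⁻¹ by
`B5DeltaA169.calG_eq_DeltaA_inv`). [cite: Balaban1984PropagatorsI, (1.71) p.30; Balaban1985RegularSpaces, (1.58) p.86] -/
theorem G8T_eq_calG (hn : 1 ≤ n) {ℓ₀ : ℝ} (hℓ : 0 < ℓ₀) : G8T n M ℓ₀ = calG n hn M (ℓ₀⁻¹ ^ 2) (a_pos hℓ) := by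
  rw [G8T, P8T_eq_DeltaA, ← B5DeltaA169.calG_eq_DeltaA_inv n hn M (ℓ₀⁻¹ ^ 2) (a_pos hℓ)]

/-- **THE DISPLAYED HYPOTHESIS HOLDS HERE**: B8's operator is invertible at U₀ = 1 on the torus — [B5] p.30 «It is an invertible
operator» (`B5DeltaA169.isUnit_DeltaA`); the flat case of [4] Thm 3.11. [cite: Balaban1984PropagatorsI, (1.71) p.30;
Balaban1985BackgroundPropagators, Thm 3.11 p.416] -/
theorem isUnit_P8T (hn : 1 ≤ n) {ℓ₀ : ℝ} (hℓ : 0 < ℓ₀) : IsUnit (P8T n M ℓ₀) := by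
  rw [P8T_eq_DeltaA]
  exact B5DeltaA169.isUnit_DeltaA n hn M _ (a_pos hℓ)

/-- … in the `IsUnit det` form used by `B8Eq157Translation`. [cite: Balaban1985RegularSpaces, (1.58) p.86] -/
theorem isUnit_P8T_det (hn : 1 ≤ n) {ℓ₀ : ℝ} (hℓ : 0 < ℓ₀) : IsUnit (P8T n M ℓ₀).det :=
  (isUnit_iff_isUnit_det _).mp (isUnit_P8T n M hn hℓ)

/-- **«Δ_a is a positive operator»** ([B5] p.30) = [4] Thm 3.11 «Δ_a, G are positive definite» at U = 1, for B8's operator on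
the torus. [cite: Balaban1984PropagatorsI, (1.71) p.30; Balaban1985BackgroundPropagators, Thm 3.11 p.416] -/
theorem P8T_posDef (hn : 1 ≤ n) {ℓ₀ : ℝ} (hℓ : 0 < ℓ₀) : (P8T n M ℓ₀).PosDef := by
  rw [P8T_eq_DeltaA]
  exact B5DeltaA169.DeltaA_posDef n hn M _ (a_pos hℓ)

/-- `G(1)·P₈ = 1`. [cite: Balaban1985RegularSpaces, (1.58) p.86] -/
theorem G8T_mul_P8T (hn : 1 ≤ n) {ℓ₀ : ℝ} (hℓ : 0 < ℓ₀) : G8T n M ℓ₀ * P8T n M ℓ₀ = 1 :=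
  nonsing_inv_mul _ (isUnit_P8T_det n M hn hℓ)

/-- `P₈·G(1) = 1`. [cite: Balaban1985RegularSpaces, (1.58) p.86] -/
theorem P8T_mul_G8T (hn : 1 ≤ n) {ℓ₀ : ℝ} (hℓ : 0 < ℓ₀) : P8T n M ℓ₀ * G8T n M ℓ₀ = 1 :=
  mul_nonsing_inv _ (isUnit_P8T_det n M hn hℓ)

/-- **NO ZERO MODES at U₀ = 1 on the torus**: a vector field with D^ηA = 0 (Curl A = 0), R(∂^{η\*}A) = 0 and Q_kA = 0 vanishes —
the `isUnit_P8_det_iff` reading of `B8Eq157Translation`, DISCHARGED in this instance.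
[cite: Balaban1984PropagatorsI, p.30 («so A = 0»); Balaban1985RegularSpaces, (1.58) p.86] -/
theorem eq_zero_of_modes_torus (hn : 1 ≤ n) {ℓ₀ : ℝ} (hℓ : 0 < ℓ₀) (A : Tor (fine n M) × Fin d → ℂ)
    (hC : CurlOp (fine n M) (n : ℂ) *ᵥ A = 0) (hR : RT n M *ᵥ ((GradOp (fine n M) (n : ℂ))ᴴ *ᵥ A) = 0)
    (hQ : QvOp n M *ᵥ A = 0) : A = 0 := by
  have hP : P8T n M ℓ₀ *ᵥ A = 0 := by
    rw [P8T_mulVec, hC, hR, hQ]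
    simp only [mulVec_zero, smul_zero, add_zero]
  have hinj := Matrix.mulVec_injective_iff_isUnit.mpr (isUnit_P8T n M hn hℓ)
  exact hinj (hP.trans (mulVec_zero _).symm)

/-- The torus gives an L² operator-norm bound for G(1) ([B5] Prop. 1.1 (1.89)/(1.90), `B5DeltaA169.opNorm_DeltaA_inv_le`) — NOT
the sup-norm bounds (1.59) of [4] Thm 3.3. [cite: Balaban1984PropagatorsI, Prop 1.1 (1.89) p.33] -/
theorem opNorm_G8T_le (hn : 1 ≤ n) {ℓ₀ : ℝ} (hℓ : 0 < ℓ₀) : ‖G8T n M ℓ₀‖ ≤ Cst d (ℓ₀⁻¹ ^ 2) := by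
  rw [G8T, P8T_eq_DeltaA]
  exact B5DeltaA169.opNorm_DeltaA_inv_le n hn M _ (a_pos hℓ)

/-! ## §2  (1.57)/(1.58) on the torus at U₀ = 1 -/

/-- `X = G(1)(P₈X)`. [cite: Balaban1985RegularSpaces, (1.58) p.86] -/
theorem eq_G8T_mulVec_P8T_mulVec (hn : 1 ≤ n) {ℓ₀ : ℝ} (hℓ : 0 < ℓ₀) (X : Tor (fine n M) × Fin d → ℂ) :
    X = G8T n M ℓ₀ *ᵥ (P8T n M ℓ₀ *ᵥ X) := by
  rw [mulVec_mulVec, G8T_mul_P8T n M hn hℓ, one_mulVec]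

/-- «L^kηQ_kA = B₁» ⟹ Q_kA = ℓ₀⁻¹B₁ (ℓ₀ = L^kη > 0). [cite: Balaban1985RegularSpaces, (1.56) p.86] -/
theorem Q_eq_of_h56 {ℓ₀ : ℝ} (hℓ : 0 < ℓ₀) {A : Tor (fine n M) × Fin d → ℂ} {B₁ : Tor M × Fin d → ℂ}
    (h56 : (ℓ₀ : ℂ) • (QvOp n M *ᵥ A) = B₁) : QvOp n M *ᵥ A = ((ℓ₀⁻¹ : ℝ) : ℂ) • B₁ := by
  have hℓC : (ℓ₀ : ℂ) ≠ 0 := by exact_mod_cast hℓ.ne'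
  rw [← h56, smul_smul, Complex.ofReal_inv, inv_mul_cancel₀ hℓC, one_smul]

/-- P₈ on A, H-free: from (1.55) D\*DA = J, (1.42) R(1)D\*A = 0 and «L^kηQ_kA = B₁»: `P₈A = J + (L^kη)⁻³·Q\*_kB₁`.
[cite: Balaban1985RegularSpaces, (1.58) p.86] -/
theorem P8T_mulVec_A {ℓ₀ : ℝ} (hℓ : 0 < ℓ₀) {A J : Tor (fine n M) × Fin d → ℂ} {B₁ : Tor M × Fin d → ℂ}
    (h55 : (1 / 2 : ℂ) • ((CurlOp (fine n M) (n : ℂ))ᴴ *ᵥ (CurlOp (fine n M) (n : ℂ) *ᵥ A)) = J)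
    (h42 : RT n M *ᵥ ((GradOp (fine n M) (n : ℂ))ᴴ *ᵥ A) = 0) (h56 : (ℓ₀ : ℂ) • (QvOp n M *ᵥ A) = B₁) :
    P8T n M ℓ₀ *ᵥ A = J + ((ℓ₀⁻¹ ^ 3 : ℝ) : ℂ) • (QvAdj n M *ᵥ B₁) := by
  rw [P8T_mulVec, h55, h42, mulVec_zero, add_zero, Q_eq_of_h56 n M hℓ h56, mulVec_smul, smul_smul]
  congr 2
  push_cast
  ring

/-- **(1.58), SECOND LINE, at U₀ = 1 on the torus**: «A = G(U₀)J + G(U₀)Σ_jQ\*_jΛ_j(L^jη)⁻³B₁» with G(1) = [B5]'s G and the single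
surviving level j = k — NO invertibility hypothesis. [cite: Balaban1985RegularSpaces, (1.58) p.86] -/
theorem eq158_line2_torus (hn : 1 ≤ n) {ℓ₀ : ℝ} (hℓ : 0 < ℓ₀) {A J : Tor (fine n M) × Fin d → ℂ}
    {B₁ : Tor M × Fin d → ℂ}
    (h55 : (1 / 2 : ℂ) • ((CurlOp (fine n M) (n : ℂ))ᴴ *ᵥ (CurlOp (fine n M) (n : ℂ) *ᵥ A)) = J)
    (h42 : RT n M *ᵥ ((GradOp (fine n M) (n : ℂ))ᴴ *ᵥ A) = 0) (h56 : (ℓ₀ : ℂ) • (QvOp n M *ᵥ A) = B₁) :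
    A = G8T n M ℓ₀ *ᵥ J + G8T n M ℓ₀ *ᵥ (((ℓ₀⁻¹ ^ 3 : ℝ) : ℂ) • (QvAdj n M *ᵥ B₁)) := by
  have h := eq_G8T_mulVec_P8T_mulVec n M hn hℓ A
  rwa [P8T_mulVec_A n M hℓ h55 h42 h56, mulVec_add] at h

/-- **(1.57) and (1.58), FIRST LINE, at U₀ = 1 on the torus**, for any operator H with the (45)-properties at B₁ (L^kηQ_kHB₁ = B₁,
R(1)∂^{η\*}HB₁ = 0 — [4] (3.110)): A₁ := A − HB₁ satisfies «D\*DA₁ = J − D\*DHB₁, Q_kA₁ = 0, R(1)D\*A₁ = 0» and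
«A = G(1)J − G(1)D\*DHB₁ + HB₁». [cite: Balaban1985RegularSpaces, (1.57)–(1.58) p.86] -/
theorem eq157_158_line1_torus (hn : 1 ≤ n) {ℓ₀ : ℝ} (hℓ : 0 < ℓ₀) (H : Matrix (Tor (fine n M) × Fin d) (Tor M × Fin d) ℂ)
    {A J : Tor (fine n M) × Fin d → ℂ} {B₁ : Tor M × Fin d → ℂ}
    (h55 : (1 / 2 : ℂ) • ((CurlOp (fine n M) (n : ℂ))ᴴ *ᵥ (CurlOp (fine n M) (n : ℂ) *ᵥ A)) = J)
    (h42 : RT n M *ᵥ ((GradOp (fine n M) (n : ℂ))ᴴ *ᵥ A) = 0) (h56 : (ℓ₀ : ℂ) • (QvOp n M *ᵥ A) = B₁)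
    (h45a : (ℓ₀ : ℂ) • (QvOp n M *ᵥ (H *ᵥ B₁)) = B₁) (h45b : RT n M *ᵥ ((GradOp (fine n M) (n : ℂ))ᴴ *ᵥ (H *ᵥ B₁)) = 0) :
    ((1 / 2 : ℂ) • ((CurlOp (fine n M) (n : ℂ))ᴴ *ᵥ (CurlOp (fine n M) (n : ℂ) *ᵥ (A - H *ᵥ B₁)))
        = J - (1 / 2 : ℂ) • ((CurlOp (fine n M) (n : ℂ))ᴴ *ᵥ (CurlOp (fine n M) (n : ℂ) *ᵥ (H *ᵥ B₁))) ∧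
      QvOp n M *ᵥ (A - H *ᵥ B₁) = 0 ∧
      RT n M *ᵥ ((GradOp (fine n M) (n : ℂ))ᴴ *ᵥ (A - H *ᵥ B₁)) = 0) ∧
    A = G8T n M ℓ₀ *ᵥ J
          - G8T n M ℓ₀ *ᵥ ((1 / 2 : ℂ) • ((CurlOp (fine n M) (n : ℂ))ᴴ *ᵥ (CurlOp (fine n M) (n : ℂ) *ᵥ (H *ᵥ B₁))))
          + H *ᵥ B₁ := by
  have hQA := Q_eq_of_h56 n M hℓ h56
  have hQH := Q_eq_of_h56 n M hℓ h45a
  have h57a : ((1 / 2 : ℂ) • ((CurlOp (fine n M) (n : ℂ))ᴴ *ᵥ (CurlOp (fine n M) (n : ℂ) *ᵥ (A - H *ᵥ B₁))))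
      = J - (1 / 2 : ℂ) • ((CurlOp (fine n M) (n : ℂ))ᴴ *ᵥ (CurlOp (fine n M) (n : ℂ) *ᵥ (H *ᵥ B₁))) := by
    rw [mulVec_sub, mulVec_sub, smul_sub, h55]
  have h57b : QvOp n M *ᵥ (A - H *ᵥ B₁) = 0 := by rw [mulVec_sub, hQA, hQH, sub_self]
  have h57c : RT n M *ᵥ ((GradOp (fine n M) (n : ℂ))ᴴ *ᵥ (A - H *ᵥ B₁)) = 0 := by
    rw [mulVec_sub, mulVec_sub, h42, h45b, sub_self]
  refine ⟨⟨h57a, h57b, h57c⟩, ?_⟩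
  have hP : P8T n M ℓ₀ *ᵥ (A - H *ᵥ B₁)
      = J - (1 / 2 : ℂ) • ((CurlOp (fine n M) (n : ℂ))ᴴ *ᵥ (CurlOp (fine n M) (n : ℂ) *ᵥ (H *ᵥ B₁))) := by
    rw [P8T_mulVec, h57a, h57c, h57b]
    simp only [mulVec_zero, smul_zero, add_zero]
  have h := eq_G8T_mulVec_P8T_mulVec n M hn hℓ (A - H *ᵥ B₁)
  rw [hP, mulVec_sub] at h
  exact sub_eq_iff_eq_add.mp h

end

end Literature.MathematicalPhysics.QuantumFieldTheory.Balaban1983to89.B8Eq158FlatTorus
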